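import Summits.ResolutionOfSingularities.ResolutionOfSingularities.Theorems.MarkedTransferCampaignW46MarkedSurfacesBasePoint
import Literature.AlgebraicGeometry.Resolution.Principalization
import Literature.AlgebraicGeometry.Resolution.StalkSpecializesLocalization
import Mathlib.Logic.Hydra
import HarnessLib

/-!
# [OURS · L1 W4.6 rung (i) SURFACES] PRINCIPALIZATION OF EVERY IDEAL SHEAF ON A REGULAR SURFACE by blowing up points of the
# non-locally-principal locus (Zariski; the `d = 2` analogue of Cossart–Piltant's threefold principalization), every characteristic

Cell res-hironaka, LADDER-RESOLUTION rung L (D-0089), slot W4.6 «restricted regimes as rungs», rung (i) SURFACES; seat res-L1-s46-pv-1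
(gen 7). The tree carries Cossart–Piltant's principalization on regular excellent THREEFOLDS as a NAMED FACT
(`Literature.AlgebraicGeometry.Resolution.CossartPiltant2019Principalization`, `Principalization.lean`: a finite composition of blowing ups
along regular integral centres inside the non-locally-principal loci, `IsRegularCentreBlowupSeq σ J`, with `J𝒪_{S′}` locally principal).
THIS FILE PROVES THE SURFACE CASE, in every characteristic and without excellence: **on an integral Noetherian regular scheme of dimension
`≤ 2`, every non-zero ideal sheaf is principalized by finitely many blow-ups of closed points of its non-locally-principal locus** — the
phase-1 engine of `…W46MarkedSurfaces.lean` (the divisorial decomposition `J𝒪 = H · K`, Cossart–Piltant 2008 Prop. 4.2, and the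
lexicographic drop of `(ord_x K, λ(𝒪_x/K_x))` over a blown-up point, Zariski–Samuel App. 5 / Huneke–Swanson 14.3.4; file
`…W46MarkedSurfacesBasePoint.lean`) run over ALL base points. Proposed `--kind proof --supports` stmt-ResolutionOfSingularities-16156
`--as helper`. Everything is OURS; nothing here is a statement of H. Hironaka's manuscript [Hironaka2017]; no typed candidate; the named fact
`CossartPiltant2019Principalization` (dimension three) is neither used nor discharged — only its CONCLUSION SHAPE is reproduced one dimension
down. AI-written; AI review is weaker than expert review.

## What is proved

* `not_isLocallyPrincipalAt_of_decomposition` — if `I = H · K` with `H` effective Cartier and `V(K)` of codimension `≥ 2`, then `I` is NOT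
  locally principal at any point of `V(K)` (cancel `H_x`; a proper non-zero principal `K_x` has a height-one prime over it — Krull — i.e. a
  codimension-one point of `V(K)`; the argument of the tree's `coe_support_codimTwoPart` for an arbitrary decomposition).
* `exists_principalization_of_decomposition` — the induction along the cut-expand order of the multiset `{(ord_x K, λ(𝒪_x/K_x)) : x ∈ V(K)}`.
* **`exists_principalization_of_dim_le_two`** — `X` integral Noetherian regular, `topologicalKrullDim X ≤ 2`, `J ≠ ⊥` ⟹
  `∃ X′ (σ : X′ ⟶ X), IsRegularCentreBlowupSeq σ J ∧ IsLocallyPrincipal (J.comap σ)` — the body of `CossartPiltant2019Principalization` with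
  `dim = 3` replaced by `dim ≤ 2` (and excellence dropped).

## Sources

* O. Zariski, P. Samuel, *Commutative Algebra* II (1960), Appendix 5, Thm. 3 and (E) p. 391. [ZariskiSamuel1960]
* V. Cossart, O. Piltant, J. Algebra 320 (2008), proof of Prop. 4.2 / Prop. 4.4; J. Algebra 529 (2019), Prop. 4.4. [CossartPiltant2008]
  [CossartPiltant2019]
* C. Huneke, I. Swanson, *Integral Closure of Ideals, Rings, and Modules* (2006), Lemma 14.3.4. [HunekeSwanson2006]
* H. Hironaka, ms. 2017-03-23 — scope only, under adjudication, not cited as fact. [Hironaka2017]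
-/

noncomputable section

set_option linter.dupNamespace false -- mandated namespace of this single-conjunct summit

open CategoryTheory AlgebraicGeometry TopologicalSpace IsLocalRing

namespace Summit.ResolutionOfSingularities.ResolutionOfSingularities.Theorems

namespace CampaignW46

open Literature.AlgebraicGeometry.Resolution
open Literature.AlgebraicGeometry.Hironaka2017
open Scheme.IdealSheafData

universe u

/-! ## §1 The non-locally-principal locus of a decomposed ideal -/

/-- **If `I = H · K` with `H` effective Cartier and `V(K)` of codimension `≥ 2`, then `I` is not locally principal at any point of `V(K)`**
(on an integral locally Noetherian scheme): were `I_x = (f)`, cancelling `H_x = (h)` in `(h) · K_x = (f)` makes `K_x = (g)` a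
proper non-zero principal ideal, and a height-one prime over `g` (Krull) is a codimension-one point of `V(K)`.
[cite: CossartPiltant2008, proof of Prop. 4.2] -/
theorem not_isLocallyPrincipalAt_of_decomposition {X : Scheme.{u}} [IsIntegral X] [IsLocallyNoetherian X]
    {I H K : X.IdealSheafData} (hHK : H * K = I) (hI : I ≠ ⊥) (hH : IsEffectiveCartier H)
    (hK : ∀ z ∈ K.support, 1 < Order.coheight z) {x : X} (hx : x ∈ K.support) : ¬ IsLocallyPrincipalAt I x := by
  intro hprin
  obtain ⟨f, hf⟩ := hprin.isPrincipal_stalkIdeal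
  replace hf : stalkIdeal I x = Ideal.span {f} := hf
  obtain ⟨h, hhnzd, hh⟩ := hH.exists_stalkIdeal_eq_span x
  have hh0 : h ≠ 0 := nonZeroDivisors.ne_zero hhnzd
  have hK0 : K ≠ ⊥ := fun h0 => hI (by rw [← hHK, h0, mul_bot])
  have hKx0 : stalkIdeal K x ≠ ⊥ := stalkIdeal_ne_bot_of_ne_bot hK0 x
  have e : Ideal.span {h} * stalkIdeal K x = Ideal.span {f} := by rw [← hh, ← hf, ← stalkIdeal_mul, hHK]
  obtain ⟨g, -, hKg⟩ := Ideal.exists_eq_span_singleton_of_span_singleton_mul_eq hh0 e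
  -- `g` is a non-zero non-unit
  have hg0 : g ≠ 0 := by
    rintro rfl
    rw [Ideal.span_singleton_eq_bot.mpr rfl] at hKg
    exact hKx0 hKg
  have hgu : ¬ IsUnit g := by
    intro hu
    have := (mem_support_iff_stalkIdeal_le _ x).mp hx
    rw [hKg, Ideal.span_singleton_le_iff_mem] at this
    exact (mem_maximalIdeal _).mp this hu
  -- a height-one prime over `g`, i.e. a codimension-one generisation `ζ ⤳ x` inside `V(K)`
  obtain ⟨P, hP, hP1, hgP⟩ := Ideal.exists_height_eq_one_of_mem_nonunits hg0 hgu
  haveI := hP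
  obtain ⟨ζ, hζx, hPζ⟩ := exists_specializes_comap_stalkSpecializes_eq x P
  have hcoh : Order.coheight ζ = 1 := by
    have h1 := coe_height_primeOfSpecializes hζx
    rw [primeOfSpecializes, ← hPζ, hP1] at h1
    exact_mod_cast h1.symm
  have hζsupp : ζ ∈ K.support := by
    rw [mem_support_iff_stalkIdeal_le, ← stalkIdeal_map_stalkSpecializes _ hζx, hKg, Ideal.map_span, Set.image_singleton,
      Ideal.span_singleton_le_iff_mem]
    have : g ∈ primeOfSpecializes hζx := by rw [primeOfSpecializes, ← hPζ]; exact hgP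
    exact this
  exact absurd (hK ζ hζsupp) (by rw [hcoh]; decide)

/-! ## §2 The induction over the base points -/

/-- **THE PRINCIPALIZATION INDUCTION.** For a multiset `μ` over `ℕ∞ ×ₗ ℕ∞`: every stage `σ : X ⟶ S` of a Cossart–Piltant sequence for
`J` (`IsRegularCentreBlowupSeq σ J`) with `X` integral Noetherian regular of dimension `≤ 2` and a factorisation `J𝒪_X = H · K`, `H`
effective Cartier, `V(K)` of codimension `≥ 2`, whose multiset of pairs `(ord_x K, λ(𝒪_x/K_x))` over `x ∈ V(K)` is `μ`, extends to a
Cossart–Piltant sequence principalizing `J`. Blow up any `x ∈ V(K)` (a non-principal point, §1); the factorisation persists with the weak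
transform of `K`, and the multiset drops in the cut-expand order (`…W46MarkedSurfacesBasePoint.lean`). [cite: ZariskiSamuel1960, App. 5 Thm. 3]
[cite: CossartPiltant2008, proof of Prop. 4.4] -/
theorem exists_principalization_of_decomposition {S : Scheme.{u}} (J : S.IdealSheafData) (μ : Multiset (ℕ∞ ×ₗ ℕ∞)) :
    ∀ {X : Scheme.{u}} [IsIntegral X] [IsNoetherian X] (σ : X ⟶ S) (_ : IsRegularCentreBlowupSeq σ J)
      (_ : Scheme.IsRegular X) (_ : topologicalKrullDim X ≤ 2) {H K : X.IdealSheafData} (_ : H * K = J.comap σ) (_ : J.comap σ ≠ ⊥)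
      (_ : IsEffectiveCartier H) (_ : ∀ x ∈ K.support, 1 < Order.coheight x)
      (B : Finset X) (_ : ∀ x, x ∈ B ↔ x ∈ K.support),
      B.val.map (fun x => toLex (idealOrder K x,
        Module.length (X.presheaf.stalk x) (X.presheaf.stalk x ⧸ stalkIdeal K x))) = μ →
      ∃ (X' : Scheme.{u}) (σ' : X' ⟶ S), IsRegularCentreBlowupSeq σ' J ∧ IsLocallyPrincipal (J.comap σ') := by
  have wf : WellFounded (Relation.CutExpand (· < ·) : Multiset (ℕ∞ ×ₗ ℕ∞) → Multiset (ℕ∞ ×ₗ ℕ∞) → Prop) :=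
    wellFounded_lt.cutExpand
  induction μ using wf.induction with
  | _ μ ih =>
  intro X _ _ σ hσ hX hd H K hHK hI hH hK B hB hμ
  classical
  haveI : IsLocallyNoetherian X := inferInstance
  have hK0 : K ≠ ⊥ := fun h => hI (by rw [← hHK, h, mul_bot])
  have hH0 : H ≠ ⊥ := fun h => hI (by rw [← hHK, h, bot_mul])
  by_cases hBe : B = ∅
  · /- no base point left: `J𝒪_X = H` is effective Cartier, hence locally principal -/
    have hKtop : K = ⊤ := by
      rw [← Scheme.IdealSheafData.support_eq_bot_iff]
      ext y
      simp only [Closeds.coe_bot, Set.mem_empty_iff_false, iff_false]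
      intro hy
      have : y ∈ B := (hB y).mpr hy
      rw [hBe] at this
      exact absurd this (Finset.notMem_empty y)
    refine ⟨X, σ, hσ, ?_⟩
    rw [← hHK, hKtop, mul_top]
    exact hH.isLocallyPrincipal
  · /- blow up a base point `x ∈ V(K)` -/
    obtain ⟨x, hxB⟩ := Finset.nonempty_iff_ne_empty.mpr hBe
    have hxK : x ∈ K.support := (hB x).mp hxB
    obtain ⟨hcoh, hR2, hx⟩ := coheight_eq_two_of_one_lt hd (hK x hxK)
    have hKcl : ∀ z ∈ (K.support : Set X), IsClosed ({z} : Set X) := fun z hz => (coheight_eq_two_of_one_lt hd (hK z hz)).2.2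
    have hxne : ({x} : Set X) ≠ Set.univ := by
      intro h
      have hg : genericPoint X ∈ ({x} : Set X) := h ▸ Set.mem_univ _
      rw [Set.mem_singleton_iff] at hg
      rw [← hg] at hxK
      exact not_mem_support_genericPoint hK0 hxK
    set P : X.IdealSheafData := vanishingIdeal ⟨{x}, hx⟩ with hP
    have hπ : IsBlowup (blowup.π P) P := blowup.isBlowup P
    have hP0 : P ≠ ⊥ := vanishingIdeal_singleton_ne_bot hx hxne
    -- the extended Cossart–Piltant sequence
    have hσ' : IsRegularCentreBlowupSeq (blowup.π P ≫ σ) J :=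
      IsRegularCentreBlowupSeq.cons (blowup.π P) σ J ⟨{x}, hx⟩ hσ (isIntegral_subscheme_vanishingIdeal_singleton hx)
        (isRegular_subscheme_vanishingIdeal_singleton hx)
        (fun y hy => by
          rw [show y = x from hy]
          exact not_isLocallyPrincipalAt_of_decomposition hHK hI hH hK hxK) hπ
    -- the new surface
    haveI : IsIntegral (blowup P) := hπ.isIntegral hP0
    haveI : IsProper (blowup.π P) := hπ.isProper
    haveI : IsLocallyNoetherian (blowup P) := LocallyOfFiniteType.isLocallyNoetherian (blowup.π P)
    haveI : CompactSpace (blowup P) := QuasiCompact.compactSpace_of_compactSpace (blowup.π P)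
    haveI : IsNoetherian (blowup P) := {}
    have hX' : Scheme.IsRegular (blowup P) :=
      hπ.isRegular_of_isRegular_subscheme hX (isRegular_subscheme_vanishingIdeal_singleton hx)
    have hd' : topologicalKrullDim (blowup P) ≤ 2 := by
      rw [(hπ.isBirational' hP0).topologicalKrullDim_eq_of_isProper]; exact hd
    -- the order `r = ord_x K` and the new decomposition `J𝒪 = (H𝒪 · 𝓘_exc^r) · τᶜ(K, r)`
    haveI := hX x
    obtain ⟨r, hr⟩ := ENat.ne_top_iff_exists.mp (idealOrder_ne_top hK0 x)
    have hKr : K ≤ P ^ r := le_vanishingIdeal_pow_of_forall_le_idealOrder hX (isRegular_subscheme_vanishingIdeal_singleton hx)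
      fun y hy => by rw [show y = x from hy, ← hr]
    set H' := H.comap (blowup.π P) * P.comap (blowup.π P) ^ r with hH'def
    set K' := controlledTransform (blowup.π P) P K r with hK'def
    have hHK' : H' * K' = J.comap (blowup.π P ≫ σ) := by
      rw [Scheme.IdealSheafData.comap_comp, ← hHK, comap_mul, hH'def, hK'def, mul_assoc,
        hπ.pow_mul_controlledTransform_eq (comap_le_comap_pow_of_le_pow hKr (blowup.π P))]
    have hI' : J.comap (blowup.π P ≫ σ) ≠ ⊥ := by
      rw [Scheme.IdealSheafData.comap_comp]
      refine hπ.comap_ne_bot ?_ hI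
      intro htop
      apply hxne
      have := congrArg (fun Z : Closeds X => (Z : Set X)) htop
      simpa [hP, Scheme.IdealSheafData.coe_support_vanishingIdeal] using this
    have hH' : IsEffectiveCartier H' := (IsEffectiveCartier.comap_of_isBlowup hπ hH).mul (hπ.isEffectiveCartier.pow r)
    have hK'c : ∀ y ∈ K'.support, 1 < Order.coheight y := fun y hy =>
      one_lt_coheight_of_mem_support_controlledTransform hX hx hxne hπ hK hr.symm hy
    -- the new base points
    have hfin' : (K'.support : Set (blowup P)).Finite := finite_support_of_one_lt_coheight hd' hK'c
    set B' : Finset (blowup P) := hfin'.toFinset with hB'def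
    have hB' : ∀ y, y ∈ B' ↔ y ∈ K'.support := fun y => by
      rw [hB'def, Set.Finite.mem_toFinset]; rfl
    -- the measure drops in the cut-expand order
    set v : X → ℕ∞ ×ₗ ℕ∞ := fun z => toLex (idealOrder K z,
      Module.length (X.presheaf.stalk z) (X.presheaf.stalk z ⧸ stalkIdeal K z)) with hv
    set v' : blowup P → ℕ∞ ×ₗ ℕ∞ := fun y => toLex (idealOrder K' y,
      Module.length ((blowup P).presheaf.stalk y) ((blowup P).presheaf.stalk y ⧸ stalkIdeal K' y)) with hv'
    have hcut : Relation.CutExpand (· < ·) (B'.val.map v') (B.val.map v) := by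
      set B₁ := B'.filter fun y => blowup.π P y ≠ x with hB₁
      set B₂ := B'.filter fun y => ¬ blowup.π P y ≠ x with hB₂
      have hsplit : B'.val.map v' = B₁.val.map v' + B₂.val.map v' := by
        rw [hB₁, hB₂, Finset.filter_val, Finset.filter_val, ← Multiset.map_add, Multiset.filter_add_not]
      have hoff : B₁.val.map v' = (B.erase x).val.map v := by
        have h1 : B₁.val.map v' = B₁.val.map (v ∘ fun y => blowup.π P y) := by
          refine Multiset.map_congr rfl fun y hy => ?_
          have hyx : blowup.π P y ≠ x := (Finset.mem_filter.mp hy).2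
          obtain ⟨ho, hl, -, -⟩ := offCentre_eq hx hπ K r hyx
          simp only [hv, hv', Function.comp_apply]
          rw [ho, hl]
        have hinj : Set.InjOn (fun y => blowup.π P y) (B₁ : Set (blowup P)) := by
          intro y hy y' hy' h
          have hyx : blowup.π P y ≠ x := (Finset.mem_filter.mp hy).2
          exact (existsUnique_preimage hx hπ hyx).unique rfl h.symm
        have himg : B₁.image (fun y => blowup.π P y) = B.erase x := by
          ext z
          simp only [Finset.mem_image, Finset.mem_erase]
          constructor
          · rintro ⟨y, hy, rfl⟩
            obtain ⟨hyB', hyx⟩ := Finset.mem_filter.mp hy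
            obtain ⟨-, -, hmemK, -⟩ := offCentre_eq hx hπ K r hyx
            exact ⟨hyx, (hB _).mpr (hmemK.mp ((hB' y).mp hyB'))⟩
          · rintro ⟨hzx, hzB⟩
            obtain ⟨y, hy, -⟩ := existsUnique_preimage hx hπ hzx
            have hyx : blowup.π P y ≠ x := by rw [hy]; exact hzx
            obtain ⟨-, -, hmemK, -⟩ := offCentre_eq hx hπ K r hyx
            exact ⟨y, Finset.mem_filter.mpr ⟨(hB' y).mpr (hmemK.mpr (hy ▸ (hB z).mp hzB)), hyx⟩, hy⟩
        rw [h1, ← Multiset.map_map, ← Finset.image_val_of_injOn hinj, himg]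
      have hover : ∀ c ∈ B₂.val.map v', c < v x := by
        intro c hc
        obtain ⟨y, hy, rfl⟩ := Multiset.mem_map.mp hc
        have hyx : blowup.π P y = x := by
          have := (Finset.mem_filter.mp hy).2
          push Not at this
          exact this
        exact toLex_lt_of_over hX hx hπ hKcl hxK hcoh hr.symm hyx
      have hold : B.val.map v = (B.erase x).val.map v + {v x} := by
        rw [add_comm, Multiset.singleton_add, ← Multiset.map_cons, Finset.erase_val, Multiset.cons_erase (Finset.mem_val.mpr hxB)]
      rw [hsplit, hoff, hold]
      exact (Relation.cutExpand_add_left _).mpr (Relation.cutExpand_singleton hover)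
    exact ih _ (hμ ▸ hcut) (blowup.π P ≫ σ) hσ' hX' hd' hHK' hI' hH' hK'c B' hB' rfl

/-! ## §3 The theorem -/

/-- **[OURS · W4.6 rung (i) SURFACES] PRINCIPALIZATION OF IDEAL SHEAVES ON REGULAR SURFACES (Zariski), every characteristic, no excellence.**
For an integral Noetherian regular scheme `X` with `topologicalKrullDim X ≤ 2` and an ideal sheaf `J ≠ ⊥` there is a finite composition
`σ : X′ ⟶ X` of blowing ups along regular integral centres (here: reduced closed points) lying in the non-locally-principal loci of the
successive transforms of `J` (`IsRegularCentreBlowupSeq σ J`) such that `J𝒪_{X′} = J.comap σ` is locally principal — the body of the tree's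
named fact `CossartPiltant2019Principalization` with «dimension three, excellent» replaced by «dimension `≤ 2`». Start of
`exists_principalization_of_decomposition` at the divisorial decomposition (tree `exists_divisorial_decomposition`).
[cite: ZariskiSamuel1960, App. 5 Thm. 3] [cite: CossartPiltant2019, Prop. 4.4 (arXiv v1: Prop. 4.3)] -/
theorem exists_principalization_of_dim_le_two {X : Scheme.{u}} [IsIntegral X] [IsNoetherian X] (hX : Scheme.IsRegular X)
    (hd : topologicalKrullDim X ≤ 2) (J : X.IdealSheafData) (hJ : J ≠ ⊥) :
    ∃ (X' : Scheme.{u}) (σ : X' ⟶ X), IsRegularCentreBlowupSeq σ J ∧ IsLocallyPrincipal (J.comap σ) := by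
  classical
  obtain ⟨H, K, hH, hHK, -, -, hK⟩ := exists_divisorial_decomposition hX hJ
  have hfin : (K.support : Set X).Finite := finite_support_of_one_lt_coheight hd hK
  have hJ1 : J.comap (𝟙 X) = J := Scheme.IdealSheafData.comap_id J
  exact exists_principalization_of_decomposition J _ (𝟙 X) (IsRegularCentreBlowupSeq.nil J) hX hd (hHK.trans hJ1.symm)
    (by rw [hJ1]; exact hJ) hH hK hfin.toFinset (fun x => by rw [Set.Finite.mem_toFinset]; rfl) rfl

end CampaignW46

end Summit.ResolutionOfSingularities.ResolutionOfSingularities.Theorems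

end
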